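import Mathlib
import Literature.MathematicalPhysics.QuantumFieldTheory.Balaban1983to89.T4TwoSpacingDefect

/-!
# T⁴ programme, node NE3 (η-rate of the minimisers) — the FLAT SKELETON of the double-layer constant:
# dimensional reduction of the double-layer row to a one-dimensional current (no logarithm)

Sixth-generation companion leaf of the NE3 prover lineage P1 (technique: implicit-function / fixed-point structure
of B11 Sect. E read as the discrete implicit-function theorem = STABILITY × CONSISTENCY; B11 = Bałaban, CMP 102
(1985) 277–309).  It concerns the STABILITY clause (T2) of the wall
`T4TwoSpacingDefect.ConsistencySized` — `dl k V ≤ C_DL·(1 + k·log L)`, `dl` = the DOUBLE-LAYER ROW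
`sup_x Σ_{y ∈ unit faces} |∇_yG_k(x,y)|` of the level-`k` propagator — and records, in the kernel, the exact
mechanism behind an observation of this generation's toy computation (below): in the FLAT block-averaged model the
double-layer row over the family of face planes normal to a lattice direction is NOT a `d`-dimensional quantity at
all — it REDUCES EXACTLY to a one-dimensional current, uniformly in the level `k` and in the dimension `d`, so that
the logarithm of (T2) is not forced by the flat part of the propagator.

THE IDENTITY ([folklore] linear algebra, §1).  Let the site set be a product `X₁ × X₂` (`X₁` = the coordinate normal
to the faces, `X₂` = the transverse coordinates) and let `E : Matrix (X₁ × X₂) X₁ ℝ` be the transverse extension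
`f ↦ f ⊗ 𝟙`.  If the inverse propagator `K` PRESERVES transversely constant functions — `K * E = E * K₁` for a
one-dimensional operator `K₁` (`ext_intertwine_iff`: `Σ_{y'} K(p,(t,y')) = K₁(p.1,t)`) — and `G * K = 1`,
`K₁ * g₁ = 1`, then `G * E = E * g₁` (`reduce`), i.e. the TRANSVERSE SUMS of the kernel of `G` are the kernel of the
one-dimensional inverse: `Σ_{y'} G(p,(t,y')) = g₁(p.1,t)` (`transverse_sum_eq`), whence the NET FLUX of `G(p,·)`
through the plane `{t} × X₂` from the plane `{t'} × X₂` is the one-dimensional difference `g₁(p.1,t') − g₁(p.1,t)`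
(`netFlux_eq`).  [model] For the flat block-averaged inverse propagator `K = −Δ + a(L^k)⁻²B_k` on a product torus
with product blocks (`B_k` = orthogonal projector onto functions constant on the unit cubes) the hypothesis holds
with `K₁ = −Δ₁ + a(L^k)⁻²B_k^{(1)}`: `Δ_transverse 𝟙 = 0` and `B^{transverse}𝟙 = 𝟙` [elementary; dictionary only —
no lattice operator is constructed here].
SIGN CONSTANCY ⇒ NO LOSS IN THE ABSOLUTE ROW (§2).  If along each face plane the normal difference
`G(p,(pre t,y')) − G(p,(t,y'))` has a constant sign in `y'` (hypothesis shape `hsign`), the double-layer row EQUALS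
the sum over planes of the absolute one-dimensional currents (`doubleLayerRow_eq_currents`) and is bounded by any
bound `J` of that one-dimensional functional (`doubleLayerRow_le_of_currents`) — a quantity blind to `d` and, for
the flat model, uniform in `k` (toy below; the 1D bound itself is NOT proved here).  §3 is the glue to the wall:
a `k`-uniform bound `dl ≤ J` gives clause (T2) with `C_DL = J` (`consistencyT2_of_uniform`,
`consistencyT2_of_currents`), the factor `(1 + k log L) ≥ 1` being simply unused.

TOY EVIDENCE (this generation; pure python locally + `kit compute` j057710, script `toy/slice_toy.py`,
`toy/flux_check.py` of the seat folder, archived under `t4/b2b-balaban-t4-ne3-p1/g6/`; EVIDENCE, not proof; flat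
scalar model `K_j = −Δ + aL^{−2j}B_j` on `(ℤ/N)^d`, `N = ℓL^k`, `a = 1`): (i) in all 20 cases computed
(`d = 1, 2, 3`; `L = 2, 3`; `ℓ = 1, 2, 3`; `k ≤ 4`) the absolute double-layer row equals the sum over face planes of
|net flux| to all printed digits — sign constancy OBSERVED; (ii) the value depends on the one-dimensional data only:
`d = 2`, `ℓ = 3`, `L = 2`, `k = 1, 2` gives 0.612069, 0.673673 = the `d = 1` values; (iii) for `ℓ = 1` it is EXACTLY
`1/2 − 1/(2N)` (`d = 2`: `k = 1…4`; `d = 3`: `k = 1, 2`; `L = 3`, `d = 2`: `k = 1, 2`) — the averaging mass drops out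
of the 1D current through the single face plane (it only sees the constant mode) and the massless cycle Green's
function gives `(N − 1)/(2N)`; (iv) for `ℓ = 2, 3` the row increases to a finite limit geometrically in `k`
(`ℓ = 2`, `L = 2`, `d = 2`: 0.4444, 0.4714, 0.4856; increments halving).  So `C_DL(flat)` is a bounded 1D current,
with NO `k log L`.

WHAT THIS DOES NOT DO (honest).  For Bałaban's covariant propagators `G_k(Ω, A)` (B9 = CMP 99 (1985) §3) a background
field breaks transverse translation invariance, `K * E = E * K₁` fails, and the reduction is only the flat
skeleton: the covariant correction to the double-layer row is what the typed `(1 + k log L)` of (T2) (generation 5)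
and the per-slice operator data of `T4SliceTelescoping` (generation 6) are for.  Sign constancy is a hypothesis
shape here, observed in the toy, not proved (a maximum-principle statement about the flat block-averaged
propagator).  Nothing is asserted about Bałaban's objects; no statement of the audited series enters; finite-T⁴
rung (B)+1 bookkeeping about MINIMISERS; no conditional (`BetaPertH`, (B), (B^μ)); nothing here bears on infinite
volume, a mass gap, or the Clay problem.  No `sorry`, axioms ⊆ Mathlib's.  Records: `t4/T4-EST-U1b-OSC.md` v1.9
(RESULT 14), GAPS § G-ne3p1-20 of the cell `pub-balaban`.
-/

noncomputable section

open Finset Real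

namespace Literature.MathematicalPhysics.QuantumFieldTheory.Balaban1983to89.T4DoubleLayerFlux

/-! ## §1 Dimensional reduction: transverse sums of `G = K⁻¹` when `K` preserves transversely constant functions -/

section Reduction

variable {X₁ X₂ : Type*} [Fintype X₁] [Fintype X₂] [DecidableEq X₁] [DecidableEq X₂]

/-- The transverse extension `f ↦ f ⊗ 𝟙` as a matrix: `(E f)(a, b) = f a`. [folklore] -/
def ext (X₁ X₂ : Type*) [DecidableEq X₁] : Matrix (X₁ × X₂) X₁ ℝ := fun p a => if p.1 = a then 1 else 0

omit [Fintype X₂] [DecidableEq X₂] in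
/-- `(E * g)(p, t) = g(p.1, t)`. [folklore] -/
theorem ext_mul_apply (g : Matrix X₁ X₁ ℝ) (p : X₁ × X₂) (t : X₁) :
    (ext X₁ X₂ * g) p t = g p.1 t := by
  simp [Matrix.mul_apply, ext]

omit [DecidableEq X₂] in
/-- `(G * E)(p, t)` is the transverse sum of the kernel of `G` over the plane `{t} × X₂`. [folklore] -/
theorem mul_ext_apply (G : Matrix (X₁ × X₂) (X₁ × X₂) ℝ) (p : X₁ × X₂) (t : X₁) :
    (G * ext X₁ X₂) p t = ∑ y' : X₂, G p (t, y') := by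
  rw [Matrix.mul_apply, Fintype.sum_prod_type]
  have h : ∀ a : X₁, ∑ b : X₂, G p (a, b) * ext X₁ X₂ (a, b) t = if a = t then ∑ b : X₂, G p (a, b) else 0 := by
    intro a
    by_cases ha : a = t <;> simp [ext, ha]
  simp_rw [h]
  simp

omit [DecidableEq X₂] in
/-- The intertwining hypothesis in coordinates: `K` maps transversely constant functions to transversely constant
functions, acting there as `K₁` — `Σ_{y'} K(p,(t,y')) = K₁(p.1, t)`. [folklore] -/
theorem ext_intertwine_iff (K : Matrix (X₁ × X₂) (X₁ × X₂) ℝ) (K₁ : Matrix X₁ X₁ ℝ) :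
    K * ext X₁ X₂ = ext X₁ X₂ * K₁ ↔ ∀ p : X₁ × X₂, ∀ t : X₁, ∑ y' : X₂, K p (t, y') = K₁ p.1 t := by
  constructor
  · intro h p t
    rw [← mul_ext_apply, h, ext_mul_apply]
  · intro h
    ext p t
    rw [mul_ext_apply, ext_mul_apply, h]

/-- **Dimensional reduction** [folklore]: if `K` preserves transversely constant functions (`K * E = E * K₁`),
`G` is a left inverse of `K` and `g₁` a right inverse of `K₁`, then `G * E = E * g₁`. [folklore] -/
theorem reduce {K G : Matrix (X₁ × X₂) (X₁ × X₂) ℝ} {K₁ g₁ : Matrix X₁ X₁ ℝ}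
    (hK : K * ext X₁ X₂ = ext X₁ X₂ * K₁) (hG : G * K = 1) (hg : K₁ * g₁ = 1) :
    G * ext X₁ X₂ = ext X₁ X₂ * g₁ := by
  calc G * ext X₁ X₂ = G * ext X₁ X₂ * (K₁ * g₁) := by rw [hg, Matrix.mul_one]
    _ = G * (ext X₁ X₂ * K₁) * g₁ := by simp only [Matrix.mul_assoc]
    _ = G * (K * ext X₁ X₂) * g₁ := by rw [hK]
    _ = G * K * ext X₁ X₂ * g₁ := by simp only [Matrix.mul_assoc]
    _ = ext X₁ X₂ * g₁ := by rw [hG, Matrix.one_mul]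

/-- Transverse sums of the kernel of `G` are the one-dimensional kernel `g₁`. [folklore] -/
theorem transverse_sum_eq {K G : Matrix (X₁ × X₂) (X₁ × X₂) ℝ} {K₁ g₁ : Matrix X₁ X₁ ℝ}
    (hK : K * ext X₁ X₂ = ext X₁ X₂ * K₁) (hG : G * K = 1) (hg : K₁ * g₁ = 1) (p : X₁ × X₂) (t : X₁) :
    ∑ y' : X₂, G p (t, y') = g₁ p.1 t := by
  rw [← mul_ext_apply, reduce hK hG hg, ext_mul_apply]

/-- **Net flux = one-dimensional current**: the net flux of `G(p, ·)` into the plane `{t'} × X₂` out of the plane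
`{t} × X₂` (sum of the normal differences along the plane) is `g₁(p.1, t') − g₁(p.1, t)`. [folklore] -/
theorem netFlux_eq {K G : Matrix (X₁ × X₂) (X₁ × X₂) ℝ} {K₁ g₁ : Matrix X₁ X₁ ℝ}
    (hK : K * ext X₁ X₂ = ext X₁ X₂ * K₁) (hG : G * K = 1) (hg : K₁ * g₁ = 1) (p : X₁ × X₂) (t t' : X₁) :
    ∑ y' : X₂, (G p (t', y') - G p (t, y')) = g₁ p.1 t' - g₁ p.1 t := by
  rw [Finset.sum_sub_distrib, transverse_sum_eq hK hG hg, transverse_sum_eq hK hG hg]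

end Reduction

/-! ## §2 Sign constancy along the planes: the absolute double-layer row is a sum of absolute 1D currents -/

/-- A finite sum of reals of one sign: `Σ |f| = |Σ f|`. [folklore] -/
theorem sum_abs_eq_abs_sum_of_sign {α : Type*} (s : Finset α) (f : α → ℝ)
    (h : (∀ a ∈ s, 0 ≤ f a) ∨ (∀ a ∈ s, f a ≤ 0)) : ∑ a ∈ s, |f a| = |∑ a ∈ s, f a| := by
  rcases h with h | h
  · rw [abs_of_nonneg (Finset.sum_nonneg h)]
    exact Finset.sum_congr rfl fun a ha => abs_of_nonneg (h a ha)
  · rw [abs_of_nonpos (Finset.sum_nonpos h), ← Finset.sum_neg_distrib]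
    exact Finset.sum_congr rfl fun a ha => abs_of_nonpos (h a ha)

section Row

variable {X₁ X₂ : Type*} [Fintype X₁] [Fintype X₂] [DecidableEq X₁] [DecidableEq X₂]

/-- **The double-layer row is a sum of absolute one-dimensional currents** (flat skeleton of (T2)): over a family
`T` of face planes `{t} × X₂` with inner neighbours `{pre t} × X₂`, if the normal difference of `G(p, ·)` has a
constant sign along each plane (`hsign`, OBSERVED in the toy, a hypothesis here), then
`Σ_{t ∈ T} Σ_{y'} |G(p,(pre t, y')) − G(p,(t, y'))| = Σ_{t ∈ T} |g₁(p.1, pre t) − g₁(p.1, t)|`. [folklore] -/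
theorem doubleLayerRow_eq_currents {K G : Matrix (X₁ × X₂) (X₁ × X₂) ℝ} {K₁ g₁ : Matrix X₁ X₁ ℝ}
    (hK : K * ext X₁ X₂ = ext X₁ X₂ * K₁) (hG : G * K = 1) (hg : K₁ * g₁ = 1)
    (T : Finset X₁) (pre : X₁ → X₁) (p : X₁ × X₂)
    (hsign : ∀ t ∈ T, (∀ y' : X₂, 0 ≤ G p (pre t, y') - G p (t, y')) ∨
      (∀ y' : X₂, G p (pre t, y') - G p (t, y') ≤ 0)) :
    ∑ t ∈ T, ∑ y' : X₂, |G p (pre t, y') - G p (t, y')| = ∑ t ∈ T, |g₁ p.1 (pre t) - g₁ p.1 t| := by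
  refine Finset.sum_congr rfl fun t ht => ?_
  have hs : (∀ y' ∈ (Finset.univ : Finset X₂), 0 ≤ G p (pre t, y') - G p (t, y')) ∨
      (∀ y' ∈ (Finset.univ : Finset X₂), G p (pre t, y') - G p (t, y') ≤ 0) := by
    rcases hsign t ht with h | h
    · exact Or.inl fun y' _ => h y'
    · exact Or.inr fun y' _ => h y'
  rw [sum_abs_eq_abs_sum_of_sign _ _ hs, netFlux_eq hK hG hg]

/-- … hence bounded by any bound of the one-dimensional current functional. [folklore] -/
theorem doubleLayerRow_le_of_currents {K G : Matrix (X₁ × X₂) (X₁ × X₂) ℝ} {K₁ g₁ : Matrix X₁ X₁ ℝ}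
    (hK : K * ext X₁ X₂ = ext X₁ X₂ * K₁) (hG : G * K = 1) (hg : K₁ * g₁ = 1)
    (T : Finset X₁) (pre : X₁ → X₁) (p : X₁ × X₂) {J : ℝ}
    (hsign : ∀ t ∈ T, (∀ y' : X₂, 0 ≤ G p (pre t, y') - G p (t, y')) ∨
      (∀ y' : X₂, G p (pre t, y') - G p (t, y') ≤ 0))
    (hJ : ∑ t ∈ T, |g₁ p.1 (pre t) - g₁ p.1 t| ≤ J) :
    ∑ t ∈ T, ∑ y' : X₂, |G p (pre t, y') - G p (t, y')| ≤ J := by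
  rw [doubleLayerRow_eq_currents hK hG hg T pre p hsign]
  exact hJ

/-- Without the sign hypothesis the net currents still bound the row from BELOW (triangle inequality), so a
measured equality `row = Σ|currents|` is exactly the statement that no cancellation occurs along the planes.
[folklore] -/
theorem currents_le_doubleLayerRow {K G : Matrix (X₁ × X₂) (X₁ × X₂) ℝ} {K₁ g₁ : Matrix X₁ X₁ ℝ}
    (hK : K * ext X₁ X₂ = ext X₁ X₂ * K₁) (hG : G * K = 1) (hg : K₁ * g₁ = 1)
    (T : Finset X₁) (pre : X₁ → X₁) (p : X₁ × X₂) :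
    ∑ t ∈ T, |g₁ p.1 (pre t) - g₁ p.1 t| ≤ ∑ t ∈ T, ∑ y' : X₂, |G p (pre t, y') - G p (t, y')| := by
  refine Finset.sum_le_sum fun t _ => ?_
  rw [← netFlux_eq hK hG hg p t (pre t)]
  exact Finset.abs_sum_le_sum_abs _ _

end Row

/-! ## §3 Glue to the wall: a `k`-uniform double-layer bound gives clause (T2) of `ConsistencySized` -/

/-- A `k`-uniform bound `dl ≤ C_DL` is the log-free form of (T2). [folklore] -/
theorem consistencyT2_of_uniform {ι : Type*} {dom : Set ι} (dl : ℕ → ι → ℝ) {CDL L : ℝ}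
    (hC : 0 ≤ CDL) (hL : 1 ≤ L) (h : ∀ k, ∀ V ∈ dom, dl k V ≤ CDL) :
    ∀ k : ℕ, ∀ V ∈ dom, dl k V ≤ CDL * (1 + k * Real.log L) := by
  intro k V hV
  have hlog : 0 ≤ (k : ℝ) * Real.log L := mul_nonneg (Nat.cast_nonneg k) (Real.log_nonneg hL)
  calc dl k V ≤ CDL := h k V hV
    _ = CDL * 1 := (mul_one _).symm
    _ ≤ CDL * (1 + k * Real.log L) := mul_le_mul_of_nonneg_left (by linarith) hC

/-- **(T2) from one-dimensional currents** (flat skeleton): per level `k` and datum `V`, a product site set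
`X₁ k × X₂ k`, a propagator `G k V` whose inverse preserves transversely constant functions with 1D reduction
`g₁ k V`, face planes `T k` with inner neighbours `pre k`, sign constancy along the planes at a point `x k V`
dominating `dl`, and a `k`-UNIFORM bound `J` on the 1D current functional ⇒ clause (T2) with `C_DL = J`.
[folklore] -/
theorem consistencyT2_of_currents {ι : Type*} {dom : Set ι} {X₁ X₂ : ℕ → Type*}
    [∀ k, Fintype (X₁ k)] [∀ k, Fintype (X₂ k)] [∀ k, DecidableEq (X₁ k)] [∀ k, DecidableEq (X₂ k)]
    (K G : ∀ k, ι → Matrix (X₁ k × X₂ k) (X₁ k × X₂ k) ℝ) (K₁ g₁ : ∀ k, ι → Matrix (X₁ k) (X₁ k) ℝ)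
    (T : ∀ k, Finset (X₁ k)) (pre : ∀ k, X₁ k → X₁ k) (x : ∀ k, ι → X₁ k × X₂ k)
    (dl : ℕ → ι → ℝ) {J L : ℝ} (hJ0 : 0 ≤ J) (hL : 1 ≤ L)
    (hK : ∀ k, ∀ V ∈ dom, K k V * ext (X₁ k) (X₂ k) = ext (X₁ k) (X₂ k) * K₁ k V)
    (hG : ∀ k, ∀ V ∈ dom, G k V * K k V = 1) (hg : ∀ k, ∀ V ∈ dom, K₁ k V * g₁ k V = 1)
    (hsign : ∀ k, ∀ V ∈ dom, ∀ t ∈ T k,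
      (∀ y' : X₂ k, 0 ≤ G k V (x k V) (pre k t, y') - G k V (x k V) (t, y')) ∨
      (∀ y' : X₂ k, G k V (x k V) (pre k t, y') - G k V (x k V) (t, y') ≤ 0))
    (hJ : ∀ k, ∀ V ∈ dom, ∑ t ∈ T k, |g₁ k V (x k V).1 (pre k t) - g₁ k V (x k V).1 t| ≤ J)
    (hdl : ∀ k, ∀ V ∈ dom,
      dl k V ≤ ∑ t ∈ T k, ∑ y' : X₂ k, |G k V (x k V) (pre k t, y') - G k V (x k V) (t, y')|) :
    ∀ k : ℕ, ∀ V ∈ dom, dl k V ≤ J * (1 + k * Real.log L) := by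
  refine consistencyT2_of_uniform dl hJ0 hL fun k V hV => ?_
  exact (hdl k V hV).trans
    (doubleLayerRow_le_of_currents (hK k V hV) (hG k V hV) (hg k V hV) (T k) (pre k) (x k V) (hsign k V hV)
      (hJ k V hV))

/-! ## §4 Sanity examples -/

/-- The hypotheses of `reduce` are jointly satisfiable (trivial instance). -/
example : (1 : Matrix (Fin 2 × Fin 3) (Fin 2 × Fin 3) ℝ) * ext (Fin 2) (Fin 3) =
    ext (Fin 2) (Fin 3) * (1 : Matrix (Fin 2) (Fin 2) ℝ) := by
  rw [Matrix.one_mul, Matrix.mul_one]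

/-- The transverse sum of the identity kernel over a plane is the 1D identity kernel (a check of the normalisation
of `ext`: `Σ_{y'} δ_{(p),(t,y')} = δ_{p.1,t}`). -/
example (p : Fin 2 × Fin 3) (t : Fin 2) :
    ∑ y' : Fin 3, (1 : Matrix (Fin 2 × Fin 3) (Fin 2 × Fin 3) ℝ) p (t, y') = (1 : Matrix (Fin 2) (Fin 2) ℝ) p.1 t :=
  transverse_sum_eq (K := 1) (K₁ := 1) (by rw [Matrix.one_mul, Matrix.mul_one]) (Matrix.one_mul 1)
    (Matrix.one_mul 1) p t

end Literature.MathematicalPhysics.QuantumFieldTheory.Balaban1983to89.T4DoubleLayerFlux
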